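import Literature.MathematicalPhysics.QuantumLattice.TorusShellCounting

/-!
# Crux `CwChiralConstruction` (item `stmt-HubbardSuperconductivity-1740`, route `ChiralWindow`):
# lattice-point counts for the free band of the torus `(ℤ/Lℤ)²`

Negative-side support lemmas from the standing disprover (cdisprove, cycle 2), part 3a: elementary
ingredients of the DENSITY PINNING lemma (part 3c, `DensityPinning.lean`: at weak coupling the crux's
density clause `n ∈ [0.52, 0.70]` forces `μ ∈ [-37/10, -1/20]`). For the free band
`ε_L(k) = -2cos(2πk₀/L) - 2cos(2πk₁/L)` (`torusBand`):

* scalar facts on `log(1 + eˣ)` (monotone, `x ≤ log(1+eˣ) ≤ x⁺ + log 2`, `1`-Lipschitz);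
* `one_sub_cos_le_cos_add_cos` — on the diamond `|a| + |b| ≤ π - d`: `cos a + cos b ≥ 1 - cos d`;
  `angle_small_of_cos_gt` — `cos θ > 4/5` forces `θ < 13/20` or `θ > 2π - 13/20` (`Real.cos_bound`);
* `card_filter_torusBand_le_ge` — LOWER COUNT: for `2m < L`, `2πm/L ≤ π - 1/3`, at least `(m+1)² + m²`
  momenta have `ε_L(k) ≤ -1/10` (the diamond `|i| + |j| ≤ m`, parametrised by its two parity classes,
  each a rotated square grid);
* `card_filter_torusBand_lt_le` — UPPER COUNT: at most `(2(13L/(40π) + 1))²` momenta have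
  `ε_L(k) < -18/5` (both cosines exceed `4/5`; each coordinate lies in two short arcs).

Sources: folklore (free-fermion band filling on a finite torus); the row-count device
`card_le_of_forall_sub_lt` and `torusBand_two_eq` are the tree's (`TorusShellCounting`).
-/

noncomputable section

namespace Summit.HubbardSuperconductivity.CwChiralConstruction.Negative

open Finset Literature.MathematicalPhysics.QuantumLattice Literature.Probability.LatticeModels

/-! ### A. Scalar inequalities for `ψ(a) = log(1 + e^{βa})` -/

section Scalar

/-- `log(1 + e^{x})` is monotone. [folklore] -/
theorem log_one_add_exp_mono {x y : ℝ} (h : x ≤ y) :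
    Real.log (1 + Real.exp x) ≤ Real.log (1 + Real.exp y) :=
  Real.log_le_log (by positivity) (by linarith [Real.exp_le_exp.2 h])

/-- `x ≤ log(1 + e^{x})`. [folklore] -/
theorem le_log_one_add_exp (x : ℝ) : x ≤ Real.log (1 + Real.exp x) := by
  calc x = Real.log (Real.exp x) := (Real.log_exp x).symm
    _ ≤ Real.log (1 + Real.exp x) := Real.log_le_log (Real.exp_pos x) (by linarith [Real.exp_pos x])

/-- For `x ≥ 0`: `log(1 + e^{x}) ≤ x + log 2`. [folklore] -/
theorem log_one_add_exp_le {x : ℝ} (hx : 0 ≤ x) : Real.log (1 + Real.exp x) ≤ x + Real.log 2 := by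
  have h1 : 1 ≤ Real.exp x := Real.one_le_exp hx
  calc Real.log (1 + Real.exp x) ≤ Real.log (2 * Real.exp x) :=
        Real.log_le_log (by positivity) (by linarith)
    _ = x + Real.log 2 := by
        rw [Real.log_mul two_ne_zero (Real.exp_pos x).ne', Real.log_exp]; ring

/-- Lipschitz: `log(1 + e^{x + t}) ≤ log(1 + e^{x}) + t` for `t ≥ 0`. [folklore] -/
theorem log_one_add_exp_add_le {x t : ℝ} (ht : 0 ≤ t) :
    Real.log (1 + Real.exp (x + t)) ≤ Real.log (1 + Real.exp x) + t := by
  have h1 : 1 ≤ Real.exp t := Real.one_le_exp ht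
  calc Real.log (1 + Real.exp (x + t)) ≤ Real.log (Real.exp t * (1 + Real.exp x)) := by
        refine Real.log_le_log (by positivity) ?_
        rw [Real.exp_add]
        nlinarith [Real.exp_pos x, Real.exp_pos t]
    _ = Real.log (1 + Real.exp x) + t := by
        rw [Real.log_mul (Real.exp_pos t).ne' (by positivity), Real.log_exp]; ring

/-- For `x ≤ 0`: `log(1 + e^{x}) ≤ e^{x} ≤ 1`. [folklore] -/
theorem log_one_add_exp_le_exp (x : ℝ) : Real.log (1 + Real.exp x) ≤ Real.exp x := by
  have := Real.log_le_sub_one_of_pos (show 0 < 1 + Real.exp x by positivity)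
  linarith

end Scalar

/-! ### B. Trigonometry: the diamond `|a| + |b| ≤ π - d` and the cap `cos θ > 0.8` -/

section Trig

open Real

/-- On the diamond `|a| + |b| ≤ π - d` (`0 ≤ d ≤ π`): `cos a + cos b ≥ 1 - cos d`. [folklore] -/
theorem one_sub_cos_le_cos_add_cos {a b d : ℝ} (hd0 : 0 ≤ d) (hdπ : d ≤ π)
    (h : |a| + |b| ≤ π - d) : 1 - Real.cos d ≤ Real.cos a + Real.cos b := by
  -- reduce to `x = |a|, y = |b| ≥ 0`
  rw [← Real.cos_abs a, ← Real.cos_abs b]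
  set x := |a| with hx
  set y := |b| with hy
  have hx0 : 0 ≤ x := abs_nonneg a
  have hy0 : 0 ≤ y := abs_nonneg b
  have hsum : x + y ≤ π - d := h
  rw [Real.cos_add_cos]
  -- `cos((x-y)/2) ≥ cos((x+y)/2) ≥ 0`
  have h1 : 0 ≤ (x + y) / 2 := by linarith
  have h2 : (x + y) / 2 ≤ π / 2 := by linarith
  have hc1 : 0 ≤ Real.cos ((x + y) / 2) := Real.cos_nonneg_of_mem_Icc ⟨by linarith, h2⟩
  have hc2 : Real.cos ((x + y) / 2) ≤ Real.cos ((x - y) / 2) := by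
    rw [← Real.cos_abs ((x - y) / 2)]
    refine Real.cos_le_cos_of_nonneg_of_le_pi (abs_nonneg _) (by linarith) ?_
    rw [abs_div, abs_two]
    have : |x - y| ≤ x + y := abs_sub_le_of_nonneg_of_le' hx0 hy0
    linarith
  -- `2 cos²((x+y)/2) = 1 + cos(x+y) ≥ 1 + cos(π - d) = 1 - cos d`
  have h3 : 2 * Real.cos ((x + y) / 2) * Real.cos ((x + y) / 2) = 1 + Real.cos (x + y) := by
    have := Real.cos_sq ((x + y) / 2)
    rw [show 2 * ((x + y) / 2) = x + y by ring] at this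
    nlinarith [this]
  have h4 : Real.cos (π - d) ≤ Real.cos (x + y) :=
    Real.cos_le_cos_of_nonneg_of_le_pi (by linarith) (by linarith) hsum
  rw [Real.cos_pi_sub] at h4
  nlinarith [mul_le_mul_of_nonneg_left hc2 (mul_nonneg zero_le_two hc1)]
where
  /-- `|x - y| ≤ x + y` for `x, y ≥ 0`. [folklore] -/
  abs_sub_le_of_nonneg_of_le' {x y : ℝ} (hx : 0 ≤ x) (hy : 0 ≤ y) : |x - y| ≤ x + y := by
    rw [abs_le]; constructor <;> linarith

/-- `cos(1/3) ≤ 0.95`, hence `1 - cos(1/3) ≥ 1/20`. [folklore] -/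
theorem one_sub_cos_third : (1 : ℝ) / 20 ≤ 1 - Real.cos (1 / 3) := by
  have h := Real.cos_bound (x := 1 / 3) (by rw [abs_le]; constructor <;> norm_num)
  rw [abs_le] at h
  have h2 := h.2
  have : |(1:ℝ) / 3| = 1 / 3 := abs_of_pos (by norm_num)
  rw [this] at h2
  nlinarith [h2]

/-- `cos(13/20) ≤ 4/5`. [folklore] -/
theorem cos_cap_le : Real.cos (13 / 20) ≤ (4 : ℝ) / 5 := by
  have h := Real.cos_bound (x := 13 / 20) (by rw [abs_le]; constructor <;> norm_num)
  rw [abs_le] at h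
  have h2 := h.2
  have : |(13:ℝ) / 20| = 13 / 20 := abs_of_pos (by norm_num)
  rw [this] at h2
  nlinarith [h2]

/-- **Cap lemma.** If `cos θ > 4/5` then `θ < 13/20` or `2π - 13/20 < θ`. [folklore] -/
theorem angle_small_of_cos_gt {θ : ℝ} (hc : (4 : ℝ) / 5 < Real.cos θ) :
    θ < 13 / 20 ∨ 2 * π - 13 / 20 < θ := by
  rcases lt_or_ge θ (13 / 20) with h | h1
  · exact Or.inl h
  rcases lt_or_ge (2 * π - 13 / 20) θ with h | h2
  · exact Or.inr h
  exfalso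
  have hπ := Real.pi_gt_three
  rcases le_or_gt θ π with hle | hgt
  · have := Real.cos_le_cos_of_nonneg_of_le_pi (by norm_num) hle h1
    linarith [cos_cap_le]
  · have h3 : Real.cos θ = Real.cos (2 * π - θ) := by
      rw [Real.cos_two_pi_sub]
    have h4 : Real.cos (2 * π - θ) ≤ Real.cos (13 / 20) :=
      Real.cos_le_cos_of_nonneg_of_le_pi (by norm_num) (by linarith) (by linarith)
    linarith [cos_cap_le]

end Trig

/-! ### C. Angles of integer representatives -/

section Angles

variable {L : ℕ} [NeZero L]

/-- `cos(2π·((i : ZMod L).val)/L) = cos(2π i/L)` for every integer `i`. [folklore] -/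
theorem cos_angle_intCast (i : ℤ) :
    Real.cos (2 * Real.pi * (((i : ZMod L).val : ℕ) : ℝ) / L) = Real.cos (2 * Real.pi * (i : ℝ) / L) := by
  have hL : (L : ℝ) ≠ 0 := by exact_mod_cast NeZero.ne L
  have hv : (((i : ZMod L).val : ℕ) : ℤ) = i % (L : ℤ) := ZMod.val_intCast i
  have hdiv : i % (L : ℤ) = i - (L : ℤ) * (i / (L : ℤ)) := by rw [Int.emod_def]
  have hcast : (((i : ZMod L).val : ℕ) : ℝ) = (i : ℝ) - (L : ℝ) * ((i / (L : ℤ) : ℤ) : ℝ) := by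
    have : (((i : ZMod L).val : ℕ) : ℝ) = (((((i : ZMod L).val : ℕ) : ℤ)) : ℝ) := by push_cast; rfl
    rw [this, hv, hdiv]
    push_cast
    ring
  rw [hcast]
  set q : ℤ := i / (L : ℤ)
  have : 2 * Real.pi * ((i : ℝ) - (L : ℝ) * (q : ℝ)) / L =
      2 * Real.pi * (i : ℝ) / L - (q : ℝ) * (2 * Real.pi) := by
    have hq : 2 * Real.pi * ((i : ℝ) - (L : ℝ) * (q : ℝ)) = 2 * Real.pi * i - ((q : ℝ) * (2 * Real.pi)) * L := by
      ring
    rw [hq, sub_div, mul_div_cancel_right₀ _ hL]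
  rw [this, Real.cos_sub_int_mul_two_pi]

omit [NeZero L] in
/-- Small integers are separated in `ZMod L`: `|i|, |j| ≤ m`, `2m < L`, `(i : ZMod L) = j` ⇒ `i = j`. [folklore] -/
theorem intCast_injOn_small {m : ℕ} (hm : 2 * m < L) {i j : ℤ} (hi : |i| ≤ m) (hj : |j| ≤ m)
    (h : (i : ZMod L) = (j : ZMod L)) : i = j := by
  rw [ZMod.intCast_eq_intCast_iff_dvd_sub] at h
  have hlt : (j - i).natAbs < (L : ℤ).natAbs := by
    rw [Int.natAbs_natCast]
    have : |j - i| ≤ 2 * m := by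
      have := abs_sub j i
      rw [abs_le] at hi hj ⊢
      constructor <;> linarith [hi.1, hi.2, hj.1, hj.2]
    have h2 : ((j - i).natAbs : ℤ) ≤ 2 * m := by
      rw [Int.natCast_natAbs]; exact this
    omega
  have := Int.eq_zero_of_dvd_of_natAbs_lt_natAbs h hlt
  omega

end Angles

/-! ### D. Lattice-point counts on the torus `(ℤ/Lℤ)²` -/

section Counts

variable {L : ℕ} [NeZero L]

/-- `|a| + |b| ≤ c` from the four sign combinations. [folklore] -/
theorem abs_add_abs_le_of_four {a b c : ℝ} (h1 : a + b ≤ c) (h2 : a - b ≤ c) (h3 : -a + b ≤ c)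
    (h4 : -a - b ≤ c) : |a| + |b| ≤ c := by
  rcases abs_cases a with ⟨ha, _⟩ | ⟨ha, _⟩ <;> rcases abs_cases b with ⟨hb, _⟩ | ⟨hb, _⟩ <;>
    rw [ha, hb] <;> linarith

/-- A torus momentum with small integer coordinates `(i, j)`, `|i| + |j| ≤ m`, `2πm/L ≤ π - 1/3`, lies
deep in the hole-doped half of the band: `ε_L(k) ≤ -1/10`. [folklore] -/
theorem torusBand_le_of_small (m : ℕ) (hangle : 2 * Real.pi * m / L ≤ Real.pi - 1 / 3) {i j : ℤ}
    (hij : |(i : ℝ)| + |(j : ℝ)| ≤ m) (k : TorusSite 2 L) (h0 : k 0 = (i : ZMod L))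
    (h1 : k 1 = (j : ZMod L)) : torusBand L k ≤ -(1 : ℝ) / 10 := by
  have hL : (0 : ℝ) < L := by exact_mod_cast Nat.pos_of_ne_zero (NeZero.ne L)
  rw [torusBand_two_eq, h0, h1, cos_angle_intCast, cos_angle_intCast]
  have hd : |2 * Real.pi * (i : ℝ) / L| + |2 * Real.pi * (j : ℝ) / L| ≤ Real.pi - 1 / 3 := by
    have hπ : 0 < 2 * Real.pi / L := by positivity
    rw [show 2 * Real.pi * (i : ℝ) / L = (2 * Real.pi / L) * i by ring,
      show 2 * Real.pi * (j : ℝ) / L = (2 * Real.pi / L) * j by ring, abs_mul, abs_mul,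
      abs_of_pos hπ, ← mul_add]
    calc 2 * Real.pi / L * (|(i : ℝ)| + |(j : ℝ)|) ≤ 2 * Real.pi / L * m :=
          mul_le_mul_of_nonneg_left hij hπ.le
      _ = 2 * Real.pi * m / L := by ring
      _ ≤ Real.pi - 1 / 3 := hangle
  have hπ3 := Real.pi_gt_three
  have key := one_sub_cos_le_cos_add_cos (by norm_num) (by linarith) hd
  have num := one_sub_cos_third
  linarith

/-- **Lower count.** If `2m < L` and `2πm/L ≤ π - 1/3` then at least `(m+1)² + m²` torus momenta
have `ε_L(k) ≤ -1/10` (the lattice points of the diamond `|i| + |j| ≤ m`, split by parity of `i + j`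
into two rotated square grids). [folklore] -/
theorem card_filter_torusBand_le_ge (m : ℕ) (hm : 2 * m < L)
    (hangle : 2 * Real.pi * m / L ≤ Real.pi - 1 / 3) :
    (m + 1) ^ 2 + m ^ 2 ≤
      (Finset.univ.filter fun k : TorusSite 2 L => torusBand L k ≤ -(1 : ℝ) / 10).card := by
  classical
  -- the parametrisation of the diamond
  let f : (Fin (m + 1) × Fin (m + 1)) ⊕ (Fin m × Fin m) → TorusSite 2 L := fun p =>
    match p with
    | Sum.inl (u, v) => ![(((u : ℤ) - v : ℤ) : ZMod L), (((u : ℤ) + v - m : ℤ) : ZMod L)]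
    | Sum.inr (u, v) => ![(((u : ℤ) - v : ℤ) : ZMod L), (((u : ℤ) + v - m + 1 : ℤ) : ZMod L)]
  have hcard : (Finset.univ : Finset ((Fin (m + 1) × Fin (m + 1)) ⊕ (Fin m × Fin m))).card =
      (m + 1) ^ 2 + m ^ 2 := by
    rw [Finset.card_univ, Fintype.card_sum, Fintype.card_prod, Fintype.card_prod, Fintype.card_fin,
      Fintype.card_fin]
    ring
  rw [← hcard]
  refine Finset.card_le_card_of_injOn f (fun p _ => ?_) ?_
  · -- lands in the set
    rw [Finset.coe_filter]
    refine ⟨Finset.mem_univ _, ?_⟩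
    rcases p with ⟨u, v⟩ | ⟨u, v⟩
    · refine torusBand_le_of_small m hangle (i := (u : ℤ) - v) (j := (u : ℤ) + v - m) ?_ (f (Sum.inl (u, v)))
        (by simp [f]) (by simp [f])
      have hu := u.isLt; have hv := v.isLt
      push_cast
      refine abs_add_abs_le_of_four ?_ ?_ ?_ ?_ <;>
      · have h1 : ((u : ℕ) : ℝ) ≤ m := by exact_mod_cast Nat.lt_succ_iff.mp hu
        have h2 : ((v : ℕ) : ℝ) ≤ m := by exact_mod_cast Nat.lt_succ_iff.mp hv
        have h3 : (0 : ℝ) ≤ (u : ℕ) := Nat.cast_nonneg _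
        have h4 : (0 : ℝ) ≤ (v : ℕ) := Nat.cast_nonneg _
        linarith
    · refine torusBand_le_of_small m hangle (i := (u : ℤ) - v) (j := (u : ℤ) + v - m + 1) ?_ (f (Sum.inr (u, v)))
        (by simp [f]) (by simp [f])
      have hu := u.isLt; have hv := v.isLt
      push_cast
      refine abs_add_abs_le_of_four ?_ ?_ ?_ ?_ <;>
      · have h1 : ((u : ℕ) : ℝ) + 1 ≤ m := by exact_mod_cast hu
        have h2 : ((v : ℕ) : ℝ) + 1 ≤ m := by exact_mod_cast hv
        have h3 : (0 : ℝ) ≤ (u : ℕ) := Nat.cast_nonneg _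
        have h4 : (0 : ℝ) ≤ (v : ℕ) := Nat.cast_nonneg _
        linarith
  · -- injective
    intro p _ p' _ hpp
    have h0 : f p 0 = f p' 0 := by rw [hpp]
    have h1 : f p 1 = f p' 1 := by rw [hpp]
    -- integer coordinates and their sizes
    have absle : ∀ (i : ℤ), -(m : ℤ) ≤ i → i ≤ m → |i| ≤ m := fun i ha hb => abs_le.2 ⟨ha, hb⟩
    rcases p with ⟨u, v⟩ | ⟨u, v⟩ <;> rcases p' with ⟨u', v'⟩ | ⟨u', v'⟩ <;>
      simp only [f, Matrix.cons_val_zero, Matrix.cons_val_one] at h0 h1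
    · have hu := u.isLt; have hv := v.isLt; have hu' := u'.isLt; have hv' := v'.isLt
      have e0 := intCast_injOn_small hm (absle _ (by omega) (by omega)) (absle _ (by omega) (by omega)) h0
      have e1 := intCast_injOn_small hm (absle _ (by omega) (by omega)) (absle _ (by omega) (by omega)) h1
      have : (u : ℕ) = u' ∧ (v : ℕ) = v' := by omega
      exact congrArg Sum.inl (Prod.ext (Fin.ext this.1) (Fin.ext this.2))
    · have hu := u.isLt; have hv := v.isLt; have hu' := u'.isLt; have hv' := v'.isLt
      have e0 := intCast_injOn_small hm (absle _ (by omega) (by omega)) (absle _ (by omega) (by omega)) h0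
      have e1 := intCast_injOn_small hm (absle _ (by omega) (by omega)) (absle _ (by omega) (by omega)) h1
      exfalso; omega
    · have hu := u.isLt; have hv := v.isLt; have hu' := u'.isLt; have hv' := v'.isLt
      have e0 := intCast_injOn_small hm (absle _ (by omega) (by omega)) (absle _ (by omega) (by omega)) h0
      have e1 := intCast_injOn_small hm (absle _ (by omega) (by omega)) (absle _ (by omega) (by omega)) h1
      exfalso; omega
    · have hu := u.isLt; have hv := v.isLt; have hu' := u'.isLt; have hv' := v'.isLt
      have e0 := intCast_injOn_small hm (absle _ (by omega) (by omega)) (absle _ (by omega) (by omega)) h0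
      have e1 := intCast_injOn_small hm (absle _ (by omega) (by omega)) (absle _ (by omega) (by omega)) h1
      have : (u : ℕ) = u' ∧ (v : ℕ) = v' := by omega
      exact congrArg Sum.inr (Prod.ext (Fin.ext this.1) (Fin.ext this.2))

/-- **Cap count in one direction.** The residues `a ∈ ℤ/Lℤ` with `cos(2πa/L) > 4/5` number at most
`2(13L/(40π) + 1)`: their angles lie in `[0, 13/20)` or `(2π - 13/20, 2π)`. [folklore] -/
theorem card_filter_cos_gt_le :
    ((Finset.univ.filter fun a : ZMod L => (4 : ℝ) / 5 < Real.cos (2 * Real.pi * (a.val : ℝ) / L)).card : ℝ) ≤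
      2 * (13 * L / (40 * Real.pi) + 1) := by
  classical
  have hL : (0 : ℝ) < L := by exact_mod_cast Nat.pos_of_ne_zero (NeZero.ne L)
  have hπ := Real.pi_pos
  set D : ℝ := 13 * L / (40 * Real.pi) with hD
  have hD0 : 0 ≤ D := by positivity
  -- split by the two arcs
  set S := Finset.univ.filter fun a : ZMod L => (4 : ℝ) / 5 < Real.cos (2 * Real.pi * (a.val : ℝ) / L)
  set S₁ := S.filter fun a : ZMod L => 2 * Real.pi * (a.val : ℝ) / L < 13 / 20
  set S₂ := S.filter fun a : ZMod L => ¬ (2 * Real.pi * (a.val : ℝ) / L < 13 / 20)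
  have hsplit : S.card = S₁.card + S₂.card := (Finset.card_filter_add_card_filter_not _).symm
  -- each arc, mapped to `ℕ` by `val`, has pairwise differences `< D`
  have key : ∀ T : Finset (ZMod L), (∀ a ∈ T, ∀ b ∈ T, ((b.val : ℕ) : ℝ) - (a.val : ℕ) < D) →
      (T.card : ℝ) ≤ D + 1 := by
    intro T hT
    have hc : (T.image ZMod.val).card = T.card :=
      Finset.card_image_of_injective _ (ZMod.val_injective L)
    rw [← hc]
    refine card_le_of_forall_sub_lt hD0 fun a ha b hb => ?_
    obtain ⟨a', ha', rfl⟩ := Finset.mem_image.1 ha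
    obtain ⟨b', hb', rfl⟩ := Finset.mem_image.1 hb
    exact hT a' ha' b' hb'
  have angle_eq : ∀ a : ZMod L, ((a.val : ℕ) : ℝ) = (2 * Real.pi * (a.val : ℝ) / L) * (L / (2 * Real.pi)) := by
    intro a; field_simp
  have h1 : (S₁.card : ℝ) ≤ D + 1 := by
    refine key S₁ fun a ha b hb => ?_
    have ha' := (Finset.mem_filter.1 ha).2
    have hb' := (Finset.mem_filter.1 hb).2
    have hb0 : 0 ≤ 2 * Real.pi * (a.val : ℝ) / L := by positivity
    rw [angle_eq a, angle_eq b, ← sub_mul]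
    calc (2 * Real.pi * (b.val : ℝ) / L - 2 * Real.pi * (a.val : ℝ) / L) * (L / (2 * Real.pi))
        < 13 / 20 * (L / (2 * Real.pi)) := by
          refine mul_lt_mul_of_pos_right ?_ (by positivity); linarith
      _ = D := by rw [hD]; field_simp; ring
  have h2 : (S₂.card : ℝ) ≤ D + 1 := by
    refine key S₂ fun a ha b hb => ?_
    have ha' := Finset.mem_filter.1 ha
    have hb' := Finset.mem_filter.1 hb
    have haS := (Finset.mem_filter.1 ha'.1).2
    have hbS := (Finset.mem_filter.1 hb'.1).2
    -- both angles are in the upper arc `(2π - 13/20, 2π)`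
    have hau : 2 * Real.pi - 13 / 20 < 2 * Real.pi * (a.val : ℝ) / L :=
      (angle_small_of_cos_gt haS).resolve_left ha'.2
    have hbl : 2 * Real.pi * (b.val : ℝ) / L ≤ 2 * Real.pi := (angle_mem_Icc b).2
    rw [angle_eq a, angle_eq b, ← sub_mul]
    calc (2 * Real.pi * (b.val : ℝ) / L - 2 * Real.pi * (a.val : ℝ) / L) * (L / (2 * Real.pi))
        < 13 / 20 * (L / (2 * Real.pi)) := by
          refine mul_lt_mul_of_pos_right ?_ (by positivity); linarith
      _ = D := by rw [hD]; field_simp; ring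
  calc (S.card : ℝ) = S₁.card + S₂.card := by rw [hsplit]; push_cast; ring
    _ ≤ (D + 1) + (D + 1) := add_le_add h1 h2
    _ = 2 * (13 * L / (40 * Real.pi) + 1) := by rw [hD]; ring

/-- **Upper count.** The torus momenta with `ε_L(k) < -18/5` have both cosines `> 4/5`, hence number
at most `(2(13L/(40π) + 1))²`. [folklore] -/
theorem card_filter_torusBand_lt_le :
    ((Finset.univ.filter fun k : TorusSite 2 L => torusBand L k < -(18 : ℝ) / 5).card : ℝ) ≤
      (2 * (13 * L / (40 * Real.pi) + 1)) ^ 2 := by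
  classical
  set S := Finset.univ.filter fun a : ZMod L => (4 : ℝ) / 5 < Real.cos (2 * Real.pi * (a.val : ℝ) / L)
  have hsub : ∀ k ∈ (Finset.univ.filter fun k : TorusSite 2 L => torusBand L k < -(18 : ℝ) / 5),
      (k 0, k 1) ∈ S ×ˢ S := by
    intro k hk
    have hk' := (Finset.mem_filter.1 hk).2
    rw [torusBand_two_eq] at hk'
    have c0 := Real.cos_le_one (2 * Real.pi * ((k 0).val : ℝ) / L)
    have c1 := Real.cos_le_one (2 * Real.pi * ((k 1).val : ℝ) / L)
    rw [Finset.mem_product]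
    constructor <;> (rw [Finset.mem_filter]; refine ⟨Finset.mem_univ _, ?_⟩; linarith)
  have hinj : Set.InjOn (fun k : TorusSite 2 L => (k 0, k 1))
      ↑(Finset.univ.filter fun k : TorusSite 2 L => torusBand L k < -(18 : ℝ) / 5) := by
    intro k _ k' _ h
    simp only [Prod.mk.injEq] at h
    funext i
    fin_cases i
    · exact h.1
    · exact h.2
  have hle := Finset.card_le_card_of_injOn (fun k : TorusSite 2 L => (k 0, k 1)) hsub hinj
  rw [Finset.card_product] at hle
  have hS := card_filter_cos_gt_le (L := L)
  have hS0 : (0 : ℝ) ≤ S.card := Nat.cast_nonneg _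
  calc ((Finset.univ.filter fun k : TorusSite 2 L => torusBand L k < -(18 : ℝ) / 5).card : ℝ)
      ≤ (S.card : ℝ) * S.card := by exact_mod_cast hle
    _ ≤ (2 * (13 * L / (40 * Real.pi) + 1)) * (2 * (13 * L / (40 * Real.pi) + 1)) :=
        mul_le_mul hS hS hS0 (hS0.trans hS)
    _ = (2 * (13 * L / (40 * Real.pi) + 1)) ^ 2 := by ring

end Counts

end Summit.HubbardSuperconductivity.CwChiralConstruction.Negative

end
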